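import Summits.ValiantsHypothesis.ValiantsHypothesis.Theorems.MonotoneRestorationOrbitCompressionQPDiCharacterisation
import Summits.ValiantsHypothesis.ValiantsHypothesis.Theorems.MonotoneRestorationOrbitCompressionQPDiHomSpan
import HarnessLib

/-!
# Route MonotoneRestoration — aside `OrbitCompressionQP` (stmt-ValiantsHypothesis-18332): EVERY
# SQUARE-SYMMETRIC POLYNOMIAL IS A CLOSED ONE-SORTED EXPRESSION; the characterisation for all `n ≥ 1`

`DiHomSpan.mem_span_diHom_of_squareSymmetric` (p820673): a diagonally `Sym_n`-invariant polynomial `p` is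
a linear combination of directed looped homomorphism polynomials of patterns on `≤ min(2 deg p, n)`
vertices.  Each such homomorphism polynomial is the closed polynomial of a product of `edge`s in the
one-sorted algebra `DiPatternExpr`, and closed polynomials with a fixed label budget form a subspace; hence:

* `sum_comp_castLE` — bookkeeping: summing `F (ℓ ∘ ι)` over all `ℓ : Fin K → Fin n` along the inclusion
  `ι : Fin a ↪ Fin K` counts every `h : Fin a → Fin n` exactly `n^{K-a}` times;
* `exists_diClose_of_squareSymmetric` — **every square-symmetric polynomial `p` (`1 ≤ n`) is `e.close n`
  for a one-sorted expression `e` with `min(2 deg p, n)` labels**;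
* `qpOrbitFamily_iff_diNarrow_one` — the one-sorted characterisation
  (`OrbitSupport.qpOrbitFamily_iff_diNarrow`) with the expression side for ALL `n ≥ 1` (the shape of the
  line's registered first stub): square-symmetric circuits of quasi-polynomial orbit size ⟺ diagonal
  invariance at `n = 0` and closed one-sorted expressions with `n^{k_n} ≤ 2^{(log₂ n + c)^c}` labels at every
  `n ≥ 1`.

Helper file (`--supports stmt-ValiantsHypothesis-18332`); def-free; nothing here is a named fact.
-/

noncomputable section

open scoped Classical

-- `Summit.ValiantsHypothesis.ValiantsHypothesis.…` is the tree's single-conjunct layout (Sub = Summit).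
set_option linter.dupNamespace false

namespace Summit.ValiantsHypothesis.ValiantsHypothesis.Theorems

namespace OrbitSupport

open Literature.Computability.AlgebraicComplexity MvPolynomial DiPatternExpr

variable {n : ℕ}

/-- Summing `F (ℓ ∘ ι)` over all `ℓ : Fin K → Fin n` along an injection `ι : Fin a → Fin K` counts every
`h : Fin a → Fin n` exactly `n^{K-a}` times. [folklore] -/
theorem sum_comp_castLE {a K : ℕ} (haK : a ≤ K) {M : Type*} [AddCommMonoid M] (F : (Fin a → Fin n) → M) :
    ∑ ℓ : Fin K → Fin n, F (ℓ ∘ Fin.castLE haK) = n ^ (K - a) • ∑ h : Fin a → Fin n, F h := by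
  rw [Finset.smul_sum]
  rw [← Finset.sum_fiberwise_of_maps_to (s := (Finset.univ : Finset (Fin K → Fin n)))
    (t := (Finset.univ : Finset (Fin a → Fin n))) (g := fun ℓ => ℓ ∘ Fin.castLE haK) (fun _ _ => Finset.mem_univ _)]
  refine Finset.sum_congr rfl fun h _ => ?_
  rw [Finset.sum_congr rfl fun ℓ hℓ => (by rw [(Finset.mem_filter.1 hℓ).2] : F (ℓ ∘ Fin.castLE haK) = F h),
    Finset.sum_const]
  congr 1
  -- the fibre over `h` is in bijection with the functions on the complement of the range of `ι`
  let ι := Fin.castLE haK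
  have hι : Function.Injective ι := Fin.castLE_injective haK
  let S : Finset (Fin K) := Finset.univ \ Finset.univ.image ι
  have hScard : S.card = K - a := by
    simp only [S, Finset.card_univ_sdiff, Finset.card_image_of_injective _ hι, Finset.card_univ,
      Fintype.card_fin]
  have hcard : (Finset.univ.filter fun ℓ : Fin K → Fin n => ℓ ∘ ι = h).card = Fintype.card (S → Fin n) := by
    refine Finset.card_bij' (fun ℓ _ => fun s : S => ℓ s) (fun g _ => fun b =>
        if hb : ∃ i, ι i = b then h (Classical.choose hb) else
          if hb' : b ∈ S then g ⟨b, hb'⟩ else h ⟨0, by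
            rcases Nat.eq_zero_or_pos a with ha | ha
            · exfalso; apply hb'; simp [S, Finset.mem_sdiff]
              intro i; exact absurd i.isLt (by omega)
            · exact ha⟩)
      (fun ℓ hℓ => Finset.mem_univ _) (fun g _ => ?_) (fun ℓ hℓ => ?_) (fun g _ => ?_)
    · rw [Finset.mem_filter]
      refine ⟨Finset.mem_univ _, funext fun i => ?_⟩
      have hb : ∃ j, ι j = ι i := ⟨i, rfl⟩
      simp only [Function.comp_apply, dif_pos hb]
      exact congrArg h (hι (Classical.choose_spec hb))
    · obtain ⟨-, hℓ⟩ := Finset.mem_filter.1 hℓ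
      funext b
      by_cases hb : ∃ i, ι i = b
      · obtain ⟨i, rfl⟩ := hb
        have hb' : ∃ j, ι j = ι i := ⟨i, rfl⟩
        simp only [dif_pos hb']
        rw [← hℓ, Function.comp_apply, hι (Classical.choose_spec hb')]
      · have hbS : b ∈ S := by
          simp only [S, Finset.mem_sdiff, Finset.mem_univ, Finset.mem_image, true_and, not_exists]
          exact fun i hi => hb ⟨i, hi⟩
        simp only [dif_neg hb, dif_pos hbS]
    · funext s
      have hs : ¬ ∃ i, ι i = (s : Fin K) := by
        rintro ⟨i, hi⟩
        have := s.2
        simp only [S, Finset.mem_sdiff, Finset.mem_univ, Finset.mem_image, true_and, not_exists] at this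
        exact this i hi
      simp only [dif_neg hs, dif_pos s.2]
  rw [hcard, Fintype.card_fun, Fintype.card_coe, hScard, Fintype.card_fin]

/-- `close` is additive. [folklore] -/
theorem diClose_add {k : ℕ} (e₁ e₂ : DiPatternExpr ℂ k) :
    (add e₁ e₂).close n = e₁.close n + e₂.close n := by
  unfold DiPatternExpr.close
  simp only [value_add, Finset.sum_add_distrib]

/-- `close` commutes with constant multiples. [folklore] -/
theorem diClose_constMul {k : ℕ} (c : ℂ) (e : DiPatternExpr ℂ k) :
    (mul (const c) e).close n = C c * e.close n := by
  unfold DiPatternExpr.close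
  simp only [value_mul, value_const, Finset.mul_sum]

/-- **A directed looped homomorphism polynomial on `a ≤ K` vertices is a closed one-sorted expression with
`K` labels** (`1 ≤ n`; the `K - a` idle labels are compensated by the constant `n^{-(K-a)}`). [folklore] -/
theorem exists_diClose_eq_diHomSum {a K : ℕ} (haK : a ≤ K) (hn : 1 ≤ n) (E : Multiset (Fin a × Fin a)) :
    ∃ e : DiPatternExpr ℂ K, e.close n =
      ∑ h : Fin a → Fin n, (E.map fun ed => (X (h ed.1, h ed.2) : MvPolynomial (Fin n × Fin n) ℂ)).prod := by
  let ι := Fin.castLE haK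
  let e₀ : DiPatternExpr ℂ K := ((E.toList.map fun ed => (ι ed.1, ι ed.2)).map
    fun ed => (edge ed.1 ed.2 : DiPatternExpr ℂ K)).foldr mul (const 1)
  have hval : ∀ ℓ : Fin K → Fin n, e₀.value n ℓ =
      (E.map fun ed => (X ((ℓ ∘ ι) ed.1, (ℓ ∘ ι) ed.2) : MvPolynomial (Fin n × Fin n) ℂ)).prod := by
    intro ℓ
    rw [value_edges_prod, List.map_map]
    conv_rhs => rw [← Multiset.coe_toList E, Multiset.map_coe, Multiset.prod_coe]
    rfl
  refine ⟨mul (const (((n : ℂ) ^ (K - a))⁻¹)) e₀, ?_⟩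
  rw [diClose_constMul]
  unfold DiPatternExpr.close
  rw [Finset.sum_congr rfl fun ℓ _ => hval ℓ,
    sum_comp_castLE haK (fun h : Fin a → Fin n =>
      (E.map fun ed => (X (h ed.1, h ed.2) : MvPolynomial (Fin n × Fin n) ℂ)).prod),
    nsmul_eq_mul, ← mul_assoc, ← map_natCast C, ← map_mul, Nat.cast_pow,
    inv_mul_cancel₀ (pow_ne_zero _ (by exact_mod_cast (show n ≠ 0 by omega))), map_one, one_mul]

/-- **EVERY SQUARE-SYMMETRIC POLYNOMIAL IS A CLOSED ONE-SORTED EXPRESSION** (`1 ≤ n`): with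
`min(2 deg p, n)` labels. [cite: DawarPagoSeppelt2025, §7 (p. 45)] -/
theorem exists_diClose_of_squareSymmetric (hn : 1 ≤ n) (p : MvPolynomial (Fin n × Fin n) ℂ)
    (hp : ∀ σ : Equiv.Perm (Fin n), rename (fun ij : Fin n × Fin n => (σ ij.1, σ ij.2)) p = p) :
    ∃ e : DiPatternExpr ℂ (min (2 * p.totalDegree) n), e.close n = p := by
  set K := min (2 * p.totalDegree) n with hK
  have hmem := DiHomSpan.mem_span_diHom_of_squareSymmetric p hp
  refine Submodule.span_induction (p := fun q _ => ∃ e : DiPatternExpr ℂ K, e.close n = q) ?_ ?_ ?_ ?_ hmem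
  · rintro q ⟨a, E, ha2, han, -, -, rfl⟩
    exact exists_diClose_eq_diHomSum (show a ≤ K by rw [hK]; exact le_min ha2 han) hn E
  · exact ⟨const 0, by
      unfold DiPatternExpr.close
      simp⟩
  · rintro q₁ q₂ - - ⟨e₁, he₁⟩ ⟨e₂, he₂⟩
    exact ⟨add e₁ e₂, by rw [diClose_add, he₁, he₂]⟩
  · rintro c q - ⟨e, he⟩
    exact ⟨mul (const c) e, by rw [diClose_constMul, he, smul_eq_C_mul]⟩

/-- **The one-sorted characterisation with the expression side at every `n ≥ 1`.** [cite: DawarPagoSeppelt2025, Theorem 1.1 and §7 (p. 45)] -/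
theorem qpOrbitFamily_iff_diNarrow_one (f : (n : ℕ) → MvPolynomial (Fin n × Fin n) ℂ) :
    (∃ c : ℕ, ∀ n : ℕ, ∃ (G : Type) (_ : Fintype G)
        (C : LabelledArithCircuit ℂ (Fin n × Fin n) Unit G),
      C.IsSymmetric (Equiv.Perm (Fin n)) ∧ C.eval (C.output ()) = f n ∧
      C.orbitSize (Equiv.Perm (Fin n)) ≤ 2 ^ ((Nat.log 2 n + c) ^ c)) ↔
    ((∀ σ : Equiv.Perm (Fin 0), ren σ (f 0) = f 0) ∧
      ∃ c : ℕ, ∀ n : ℕ, 1 ≤ n → ∃ (k : ℕ) (e : DiPatternExpr ℂ k),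
        n ^ k ≤ 2 ^ ((Nat.log 2 n + c) ^ c) ∧ e.close n = f n) := by
  rw [qpOrbitFamily_iff_diNarrow]
  constructor
  · rintro ⟨hinv, c, n₀, hc⟩
    refine ⟨hinv 0, ?_⟩
    -- small `n`: closed expressions with `min (2 deg) n` labels, absorbed in the constant
    have hsmall : ∀ n : ℕ, ∃ k : ℕ, 1 ≤ n → ∃ e : DiPatternExpr ℂ k, e.close n = f n := by
      intro n
      by_cases hn : 1 ≤ n
      · obtain ⟨e, he⟩ := exists_diClose_of_squareSymmetric hn (f n) (hinv n)
        exact ⟨_, fun _ => ⟨e, he⟩⟩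
      · exact ⟨0, fun h => absurd h hn⟩
    choose kk hkk using hsmall
    set c' : ℕ := max c ((Finset.range n₀).sup fun n => n ^ kk n) with hc'
    refine ⟨c', fun n hn => ?_⟩
    rcases Nat.lt_or_ge n n₀ with hlt | hge
    · obtain ⟨e, he⟩ := hkk n hn
      refine ⟨kk n, e, ?_, he⟩
      have h1 : n ^ kk n ≤ c' :=
        (Finset.le_sup (f := fun n => n ^ kk n) (Finset.mem_range.2 hlt)).trans (le_max_right _ _)
      calc n ^ kk n ≤ c' := h1
        _ ≤ (Nat.log 2 n + c') ^ c' := by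
            rcases Nat.eq_zero_or_pos c' with h0 | h0
            · rw [h0] at h1 ⊢
              simp
            · exact (Nat.le_add_left c' _).trans (Nat.le_self_pow h0.ne' _)
        _ ≤ 2 ^ ((Nat.log 2 n + c') ^ c') := Nat.lt_two_pow_self.le
    · obtain ⟨k, e, hk, he⟩ := hc n hge
      exact ⟨k, e, hk.trans (OrbitCompressionForms.qp_mono (le_max_left _ _)), he⟩
  · rintro ⟨h0, c, hc⟩
    refine ⟨fun n σ => ?_, c, 1, fun n hn => hc n hn⟩
    rcases Nat.eq_zero_or_pos n with rfl | hn
    · exact h0 σ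
    · obtain ⟨k, e, -, he⟩ := hc n hn
      rw [← he]
      exact DiPatternExpr.rename_perm_close n σ e

end OrbitSupport

end Summit.ValiantsHypothesis.ValiantsHypothesis.Theorems

end
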